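import Mathlib
import HarnessLib
import Literature.MathematicalPhysics.QuantumLattice.HubbardEffectiveActionCTTimeReversal
import Literature.MathematicalPhysics.QuantumLattice.HubbardEffectiveActionCTSpinFlip
import Summits.HubbardSuperconductivity.HubbardSuperconductivity.Theorems.KLProgrammeKLRegimeSplitValueIdentification

/-!
# Route `KLProgramme` — crux K3, ENGINE child (`KLRegimeEngineV7`, stmt-HubbardSuperconductivity-19662): REALITY / CROSSING of the
# quartic running couplings — `conj λ_n^{σσ'}(k₁,k₂,k₃) = λ_n^{σ'σ}(k₃, k₁−k₂+k₃, k₁)`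

Cell gate-hubbard-kl, seat p3 (g4); companion of `KLProgrammeKLRegimeEngineQuarticSpinWard.lean` (the `SU(2)` Ward identity) and
`KLProgrammeKLRegimeEngineSelfEnergySymmetric.lean` ((E0)).  Time reversal acts on the kernels of
`𝒢^K_Λ = hubbardEffectiveActionCT L M β U μ h K Λ` by frequency reflection and complex conjugation
(`kernel_hubbardEffectiveActionCT_timeRev`, `Literature/…/HubbardEffectiveActionCTTimeReversal.lean`, BGM 2006 §2.1 (5)); combined
with the antisymmetry of kernels under the even leg permutation `(0 2)(1 3)` (`klka_kernel_comp_perm`) this gives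
* **`kernel_hubbardEffectiveActionCT_quartic_crossing`** — `conj F₄((ω₁p₁σ₁)⁺,(ω₂p₂σ₂)⁻,(ω₃p₃σ₃)⁺,(ω₄p₄σ₄)⁻) =
  F₄((−ω₃p₃σ₃)⁺,(−ω₄p₄σ₄)⁻,(−ω₁p₁σ₁)⁺,(−ω₂p₂σ₂)⁻)` (any seed `h`, frame `K`, scale `Λ`);
* **`klQuarticValue_conj`** — for the engine's values (`…SplitPredicatesV3.klQuarticValue`, legs `(ω₀,k₁)σ⁺,(ω₀,k₂)σ⁻,(−ω₀,k₃)σ'⁺,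
  (−ω₀,k₁−k₂+k₃)σ'⁻`): `conj λ_n^{σσ'}(k₁,k₂,k₃) = λ_n^{σ'σ}(k₃, k₁−k₂+k₃, k₁)`;
* **`klQuarticValue_conj_01`** — with the spin flip (`kernel_hubbardEffectiveActionCT_spinFlip`, BGM §2.1 (1)):
  `conj λ_n^{↑↓}(k₁,k₂,k₃) = λ_n^{↑↓}(k₃, k₁−k₂+k₃, k₁)` — the `(0,1)` family the engine slot carries is closed under conjugation.
Everything is proved; no definitions.
-/

noncomputable section

namespace Summit.HubbardSuperconductivity.HubbardSuperconductivity.Theorems.KLRegimeSplit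

set_option linter.dupNamespace false -- summit = problem name (single-conjunct summit), D-0017

open scoped ComplexConjugate
open Literature.MathematicalPhysics.QuantumLattice Literature.Probability.LatticeModels Finset
open Summit.HubbardSuperconductivity.HubbardSuperconductivity.Theorems.KLProgrammeLegKernels

section Model

variable (L M : ℕ) [NeZero L]

/-- **Crossing / reality of the quartic kernels**: complex conjugation = frequency reflection (time reversal) followed by the even
leg permutation `(0 2)(1 3)`, for legs `(ψ̂⁺, ψ̂⁻, ψ̂⁺, ψ̂⁻)`; any seed, frame and scale. -/
theorem kernel_hubbardEffectiveActionCT_quartic_crossing (β U μ h : ℝ) (K : TrigPolyC4v) (Λ : ℝ) (ω₁ ω₂ ω₃ ω₄ : MatsubaraIdx M)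
    (p₁ p₂ p₃ p₄ : TorusSite 2 L) (σ₁ σ₂ σ₃ σ₄ : Fin 2) :
    conj (kernel ℂ (hubbardEffectiveActionCT L M β U μ h K Λ) 4
        ![(((ω₁, p₁), σ₁), 0), (((ω₂, p₂), σ₂), 1), (((ω₃, p₃), σ₃), 0), (((ω₄, p₄), σ₄), 1)]) =
      kernel ℂ (hubbardEffectiveActionCT L M β U μ h K Λ) 4
        ![(((ω₃.rev, p₃), σ₃), 0), (((ω₄.rev, p₄), σ₄), 1), (((ω₁.rev, p₁), σ₁), 0), (((ω₂.rev, p₂), σ₂), 1)] := by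
  set G := hubbardEffectiveActionCT L M β U μ h K Λ with hG
  -- time reversal
  have hT := kernel_hubbardEffectiveActionCT_timeRev L M β U μ h K Λ 4
    ![(((ω₁, p₁), σ₁), 0), (((ω₂, p₂), σ₂), 1), (((ω₃, p₃), σ₃), 0), (((ω₄, p₄), σ₄), 1)]
  have hX : ((Equiv.prodCongr (Equiv.prodCongr (Equiv.prodCongr Fin.revPerm (Equiv.refl (TorusSite 2 L))) (Equiv.refl (Fin 2)))
      (Equiv.refl (Fin 2))) ∘
        (![(((ω₁, p₁), σ₁), 0), (((ω₂, p₂), σ₂), 1), (((ω₃, p₃), σ₃), 0), (((ω₄, p₄), σ₄), 1)] : Fin 4 → HubbardFieldIdx L M)) =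
      ![(((ω₁.rev, p₁), σ₁), 0), (((ω₂.rev, p₂), σ₂), 1), (((ω₃.rev, p₃), σ₃), 0), (((ω₄.rev, p₄), σ₄), 1)] := by
    funext i; fin_cases i <;> rfl
  rw [hX] at hT
  rw [← hG] at hT
  rw [← hT]
  -- the even permutation `(0 2)(1 3)`
  have hπ := klka_kernel_comp_perm ℂ G
    ![(((ω₁.rev, p₁), σ₁), 0), (((ω₂.rev, p₂), σ₂), 1), (((ω₃.rev, p₃), σ₃), 0), (((ω₄.rev, p₄), σ₄), 1)]
    (Equiv.swap (0 : Fin 4) 2 * Equiv.swap (1 : Fin 4) 3)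
  have hY : (![(((ω₁.rev, p₁), σ₁), 0), (((ω₂.rev, p₂), σ₂), 1), (((ω₃.rev, p₃), σ₃), 0), (((ω₄.rev, p₄), σ₄), 1)] :
      Fin 4 → HubbardFieldIdx L M) ∘ (Equiv.swap (0 : Fin 4) 2 * Equiv.swap (1 : Fin 4) 3) =
      ![(((ω₃.rev, p₃), σ₃), 0), (((ω₄.rev, p₄), σ₄), 1), (((ω₁.rev, p₁), σ₁), 0), (((ω₂.rev, p₂), σ₂), 1)] := by
    funext i; fin_cases i <;> rfl
  rw [hY, Equiv.Perm.sign_mul, Equiv.Perm.sign_swap (by decide), Equiv.Perm.sign_swap (by decide)] at hπ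
  rw [hπ]
  simp

/-- **Reality / crossing of the quartic running couplings**: `conj λ_n^{σσ'}(k₁,k₂,k₃) = λ_n^{σ'σ}(k₃, k₁−k₂+k₃, k₁)` for every
scale, volume, temperature and all parameters (the fourth momentum of the right side is `k₃ − (k₁−k₂+k₃) + k₁ = k₂`). -/
theorem klQuarticValue_conj [NeZero M] (β U μ : ℝ) (K : TrigPolyC4v) (n : ℕ) (σ σ' : Fin 2) (k₁ k₂ k₃ : TorusSite 2 L) :
    conj (klQuarticValue L M β U μ K n σ σ' k₁ k₂ k₃) = klQuarticValue L M β U μ K n σ' σ k₃ (k₁ - k₂ + k₃) k₁ := by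
  have hk : k₃ - (k₁ - k₂ + k₃) + k₁ = k₂ := by abel
  simp only [klQuarticValue, vertexFn, klEffectiveAction, map_mul, Complex.conj_ofReal, hk]
  rw [kernel_hubbardEffectiveActionCT_quartic_crossing L M β U μ 0 K (klScale klE0 n)]
  simp only [Fin.rev_rev]

/-- **The `(↑,↓)` family is closed under conjugation**: `conj λ_n^{↑↓}(k₁,k₂,k₃) = λ_n^{↑↓}(k₃, k₁−k₂+k₃, k₁)` (crossing + spin flip). -/
theorem klQuarticValue_conj_01 [NeZero M] (β U μ : ℝ) (K : TrigPolyC4v) (n : ℕ) (k₁ k₂ k₃ : TorusSite 2 L) :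
    conj (klQuarticValue L M β U μ K n 0 1 k₁ k₂ k₃) = klQuarticValue L M β U μ K n 0 1 k₃ (k₁ - k₂ + k₃) k₁ := by
  rw [klQuarticValue_conj]
  -- spin flip `λ^{↓↑} = λ^{↑↓}`
  simp only [klQuarticValue, vertexFn, klEffectiveAction]
  congr 1
  have h := kernel_hubbardEffectiveActionCT_spinFlip L M β U μ K (klScale klE0 n) 4
    ![(((omega0 M, k₃), 0), 0), (((omega0 M, k₁ - k₂ + k₃), 0), 1), ((((omega0 M).rev, k₁), 1), 0),
      ((((omega0 M).rev, k₃ - (k₁ - k₂ + k₃) + k₁), 1), 1)]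
  have hX : ((Equiv.prodCongr (Equiv.prodCongr (Equiv.refl (FreqMomentum L M)) (Equiv.swap (0 : Fin 2) 1)) (Equiv.refl (Fin 2))) ∘
      (![(((omega0 M, k₃), 0), 0), (((omega0 M, k₁ - k₂ + k₃), 0), 1), ((((omega0 M).rev, k₁), 1), 0),
        ((((omega0 M).rev, k₃ - (k₁ - k₂ + k₃) + k₁), 1), 1)] : Fin 4 → HubbardFieldIdx L M)) =
      ![(((omega0 M, k₃), 1), 0), (((omega0 M, k₁ - k₂ + k₃), 1), 1), ((((omega0 M).rev, k₁), 0), 0),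
        ((((omega0 M).rev, k₃ - (k₁ - k₂ + k₃) + k₁), 0), 1)] := by
    funext i; fin_cases i <;> rfl
  rw [hX] at h
  exact h

end Model

end Summit.HubbardSuperconductivity.HubbardSuperconductivity.Theorems.KLRegimeSplit

end
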